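import Summits.Parity.BatemanHorn.Statement
import Summits.Parity.GeneralizedHardyLittlewood.Statement
import Literature.NumberTheory.Sieve.ParityBatemanHorn
import Literature.NumberTheory.Sieve.LinearEquationsInPrimes
import HarnessLib

/-!
# Parity — problem statement (D-0013; operator-created)

`Parity := BatemanHorn ∧ GeneralizedHardyLittlewood`.

* `BatemanHorn` (Bateman–Horn, Math. Comp. 16 (1962), (1)): for `f₁, …, f_k ∈ ℤ[X]` irreducible,
  with positive leading coefficients, pairwise not differing by a constant factor, and such that
  `∏ fᵢ` has no fixed prime divisor (`ω(p) < p` for all `p`),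
  `#{n ≤ x : all fᵢ(n) prime} ~ C(f)/(∏ deg fᵢ) · x/(log x)^k` with
  `C(f) = ∏_p (1 - 1/p)^{-k} (1 - ω(p)/p)` (ordered product) — the Literature statement
  `Literature.NumberTheory.Sieve.BatemanHornConjecture`, imported not restated.
* `GeneralizedHardyLittlewood` (Green–Tao, Ann. Math. 171 (2010), Conjecture 1.2, ALL
  complexities): for positive integers `d, t, L`, uniformly over systems `Ψ = (ψ₁, …, ψ_t)` of
  non-constant, pairwise non-proportional affine-linear forms on `ℤ^d` with `‖Ψ‖_N ≤ L` and convex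
  `K ⊆ [-N, N]^d`, `∑_{n ∈ K ∩ ℤ^d} ∏ᵢ Λ(ψᵢ(n)) = β_∞ ∏_p β_p + o_{t,d,L}(N^d)` — the Literature
  statement `Literature.NumberTheory.Sieve.GeneralizedHardyLittlewood`, imported not restated. (The finite-complexity case is
  the Green–Tao–Ziegler theorem `Literature.NumberTheory.Sieve.GreenTaoZiegler2012_finiteComplexity`; the open content is the
  infinite-complexity case: prime `k`-tuples, twin primes, Goldbach asymptotics.)

The two conjuncts are mutually non-implying (BH has non-linear polynomials in one variable; GHL has
linear forms in several variables); their common part is the `d = 1` linear case (Dickson /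
Hardy–Littlewood `k`-tuples).
-/

/-- **Parity** (D-0013, tier 2): `Parity := BatemanHorn ∧ GeneralizedHardyLittlewood`.
BatemanHorn: simultaneous prime values of irreducible `f₁ … f_k ∈ ℤ[X]` with no fixed prime divisor
have the singular-series asymptotic. GeneralizedHardyLittlewood (Green–Tao form, all
complexities): for every finite system of non-degenerate affine-linear forms `ℤ^d → ℤ^t` of bounded
size and every convex `K ⊆ [-N,N]^d`, `∑_{n ∈ K ∩ ℤ^d} ∏ᵢ Λ(ψᵢ(n)) = β_∞ ∏_p β_p + o(N^d)`.
[problem: parity] -/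
def Parity : Prop := BatemanHorn ∧ GeneralizedHardyLittlewood
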